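import Summits.AnomalousDissipation.AnomalousDissipation.Theorems.SawtoothPulseCascadeK1LocalisedCascadeKHTransportDuality

/-!
# K2 lane (route-2 `SawtoothPulseCascade`, crux dir `K1LocalisedCascade`): the energy-form transport LOWER bound for a low column — a sawtooth shear of strain `θ ≤ 8` keeps a definite fraction of the windowed lattice energy of a band-limited profile on the columns `|b| ≤ 2` (input-energy lower bound for once-transported H pairs, structure theorem #6 for H-type input cells, A28-20)

Helper file of the K2 lane (ACL item stmt-AnomalousDissipation-19491). In p4's `vTransport` (crux copy of `K2ConeSketch`) a column profile
`ψ(x) = Σ_{m∈S} z(m) e^{2πi(α+m)x}` on the line `b = β+n` is multiplied by the unimodular Lipschitz transport phase `u(x) = e^{−2πibθ·tri(x)}` and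
re-expanded on the output window `W`; the column's level-energy weights are `1/((α+m′)² + b²)`. The UPPER bound (`…KHTransportDuality`,
`transport_energy_duality`) is `θ² + 2`; here is the converse for the columns the debris age law needs. THE BOUND (`transport_column_energy_lower`):
if the profile is band-limited, `(α+m)²‖z m‖² ≤ H²‖z m‖²` on `S`, every integer outside the window satisfies `|α+m′| ≥ R`, and
`2·G ≤ R²` with `G = (θ′²+2)(H² + (bθ/θ′)²)` for some auxiliary `θ′ ≠ 0`, then
`Σ_{m′∈W} |⟨ψu, e_{m′}⟩|²/((α+m′)²+b²) ≥ Σ_{m∈S}‖z m‖² / (4(G + b²))`.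
PROOF (1-D duality run backwards): (1) the tree's analytic core `weighted_coeff_sum_conjTransport_le` applied at the RESCALED pair `(b′, θ′) = (−bθ/θ′, θ′)`
(same phase `e^{−2πibθ·tri}`) gives `Σ_{T} (α+m′)²|⟨ψu,e_{m′}⟩|² ≤ G·Σ‖z‖²` for every finite `T` (`weighted_coeff_sum_transport_le_rescaled`); (2) Parseval
(`hasSum_sq_coeff`): `Σ_{m′∈ℤ} |⟨ψu,e_{m′}⟩|² = ∫|ψ|² = Σ‖z‖²` (`hasSum_sq_transport_coeff`), and the truncation tail `Σ_{m′∉W} ≤ G·Σ‖z‖²/R² ≤ ½Σ‖z‖²`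
(`sum_sq_transport_coeff_window_ge`), so half the `L²` mass stays in the window; (3) Cauchy–Schwarz
`(Σ_W |c|²)² ≤ (Σ_W |c|²/w)(Σ_W w|c|²)` (`sq_sum_le_sum_div_mul_sum_mul`) with `Σ_W w|c|² ≤ (G + b²)Σ‖z‖²`. Used by the crux file `K2DebrisAgeLaw.lean` §9 on the
columns `b ∈ {β−1, β}` (`θ′ = 1`, `H = 2^s`) and, for the degenerate class `(0,0)` at shell `0`, on `b ∈ {1, 2}` (`θ′ = 8`, `H = 0`).
No definitions; nothing about the crux by name. [cite: ElgindiLissMattingly2025, §1 (H_α, V_α)] [problem: turb]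
-/

-- `Summit.<Summit>.<Problem>`: single-conjunct summit, the duplicate namespace segment is deliberate.
set_option linter.dupNamespace false

noncomputable section

namespace Summit.AnomalousDissipation.AnomalousDissipation.Theorems.SawtoothPulseCascade.K2PhaseBudget

open Finset MeasureTheory intervalIntegral Set Filter Literature.Analysis.FluidPDE.SawtoothCascade

/-- The rescaled conjugate phase of the analytic core is p4's transport phase: `e^{2πi(−bθ/θ′)θ′·tri}·ψ = ψ·e^{−2πibθ·tri}` (`θ′ ≠ 0`). [folklore] -/
theorem conjPhase_rescale_mul (b θ : ℝ) {θ' : ℝ} (hθ' : θ' ≠ 0) (ψ : ℂ) (x : ℝ) :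
    Complex.exp (((2 * Real.pi * (-(b * θ) / θ') * θ' * triWave x : ℝ) : ℂ) * Complex.I) * ψ =
      ψ * Complex.exp (-((2 * Real.pi * b * θ * triWave x : ℝ) : ℂ) * Complex.I) := by
  rw [mul_comm]
  have h : 2 * Real.pi * (-(b * θ) / θ') * θ' * triWave x = -(2 * Real.pi * b * θ * triWave x) := by
    field_simp
  rw [h]
  push_cast
  ring_nf

/-- **The analytic core at a rescaled pair.** For the column profile `ψ = Σ_{m∈S} z(m)e^{2πi(α+m)x}` times p4's transport phase `u = e^{−2πibθ·tri}` and
every finite set `S′` of output modes: `Σ_{m′∈S′} (α+m′)²·|⟨ψu, e_{m′}⟩|² ≤ (θ′²+2)·(Σ_{S}(α+m)²‖z‖² + (bθ/θ′)²·Σ_{S}‖z‖²)` for EVERY auxiliary `θ′ ≠ 0`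
(`weighted_coeff_sum_conjTransport_le` at `(b′, θ′) = (−bθ/θ′, θ′)`, which has the same phase; the `b′²`-weighted part of its left side is dropped).
[cite: ElgindiLissMattingly2025, §1 (H_α, V_α)] -/
theorem weighted_coeff_sum_transport_le_rescaled (α b θ : ℝ) {θ' : ℝ} (hθ' : θ' ≠ 0) (S S' : Finset ℤ) (z : ℤ → ℂ) :
    ∑ m' ∈ S', (α + m') ^ 2 * ‖∫ x in (-(1 / 2 : ℝ))..(1 / 2), ((∑ m ∈ S, z m * Complex.exp ((2 * Real.pi * (α + m) * x : ℝ) * Complex.I)) *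
        Complex.exp (-((2 * Real.pi * b * θ * triWave x : ℝ) : ℂ) * Complex.I)) * Complex.exp (-(2 * Real.pi * (α + m') * x : ℝ) * Complex.I)‖ ^ 2 ≤
      (θ' ^ 2 + 2) * (∑ m ∈ S, (α + m) ^ 2 * ‖z m‖ ^ 2 + (b * θ / θ') ^ 2 * ∑ m ∈ S, ‖z m‖ ^ 2) := by
  have h := weighted_coeff_sum_conjTransport_le α (-(b * θ) / θ') θ' S' S z
  have e : ∀ m' : ℤ, (∫ x in (-(1 / 2) : ℝ)..(1 / 2 : ℝ), (Complex.exp (((2 * Real.pi * (-(b * θ) / θ') * θ' * triWave x : ℝ) : ℂ) * Complex.I) *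
      (∑ m ∈ S, z m * Complex.exp ((2 * Real.pi * (α + m) * x : ℝ) * Complex.I))) * Complex.exp (-(2 * Real.pi * (α + m') * x : ℝ) * Complex.I)) =
      ∫ x in (-(1 / 2 : ℝ))..(1 / 2), ((∑ m ∈ S, z m * Complex.exp ((2 * Real.pi * (α + m) * x : ℝ) * Complex.I)) *
        Complex.exp (-((2 * Real.pi * b * θ * triWave x : ℝ) : ℂ) * Complex.I)) * Complex.exp (-(2 * Real.pi * (α + m') * x : ℝ) * Complex.I) := by
    intro m'
    refine intervalIntegral.integral_congr fun x _ => ?_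
    rw [conjPhase_rescale_mul b θ hθ' _ x]
  simp_rw [e] at h
  have hsq : (-(b * θ) / θ') ^ 2 = (b * θ / θ') ^ 2 := by rw [neg_div, neg_sq]
  rw [hsq] at h
  have hB : 0 ≤ (b * θ / θ') ^ 2 := sq_nonneg _
  calc ∑ m' ∈ S', (α + m') ^ 2 * ‖∫ x in (-(1 / 2 : ℝ))..(1 / 2), ((∑ m ∈ S, z m * Complex.exp ((2 * Real.pi * (α + m) * x : ℝ) * Complex.I)) *
        Complex.exp (-((2 * Real.pi * b * θ * triWave x : ℝ) : ℂ) * Complex.I)) * Complex.exp (-(2 * Real.pi * (α + m') * x : ℝ) * Complex.I)‖ ^ 2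
      ≤ ∑ m' ∈ S', ((α + m') ^ 2 + (b * θ / θ') ^ 2) * ‖∫ x in (-(1 / 2 : ℝ))..(1 / 2), ((∑ m ∈ S, z m * Complex.exp ((2 * Real.pi * (α + m) * x : ℝ) * Complex.I)) *
        Complex.exp (-((2 * Real.pi * b * θ * triWave x : ℝ) : ℂ) * Complex.I)) * Complex.exp (-(2 * Real.pi * (α + m') * x : ℝ) * Complex.I)‖ ^ 2 :=
        Finset.sum_le_sum fun m' _ => mul_le_mul_of_nonneg_right (le_add_of_nonneg_right hB) (sq_nonneg _)
    _ ≤ (θ' ^ 2 + 2) * ∑ m ∈ S, ((α + m) ^ 2 + (b * θ / θ') ^ 2) * ‖z m‖ ^ 2 := h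
    _ = (θ' ^ 2 + 2) * (∑ m ∈ S, (α + m) ^ 2 * ‖z m‖ ^ 2 + (b * θ / θ') ^ 2 * ∑ m ∈ S, ‖z m‖ ^ 2) := by
        congr 1
        rw [Finset.mul_sum, ← Finset.sum_add_distrib]
        exact Finset.sum_congr rfl fun m _ => by ring

/-- `‖e^{−2πibθ·tri(x)}‖ = 1`. [folklore] -/
theorem norm_transportPhase'' (b θ x : ℝ) : ‖Complex.exp (-((2 * Real.pi * b * θ * triWave x : ℝ) : ℂ) * Complex.I)‖ = 1 := by
  rw [show -((2 * Real.pi * b * θ * triWave x : ℝ) : ℂ) * Complex.I = ((-(2 * Real.pi * b * θ * triWave x) : ℝ) : ℂ) * Complex.I by push_cast; ring,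
    Complex.norm_exp_ofReal_mul_I]

/-- **Parseval for the transported column:** `Σ_{m′∈ℤ} |⟨ψu, e_{m′}⟩|² = Σ_{m∈S}‖z m‖²` (the phase is unimodular; `hasSum_sq_coeff` + `integral_norm_sq_blochPoly`).
[folklore] -/
theorem hasSum_sq_transport_coeff (α b θ : ℝ) (S : Finset ℤ) (z : ℤ → ℂ) :
    HasSum (fun m' : ℤ => ‖∫ x in (-(1 / 2 : ℝ))..(1 / 2), ((∑ m ∈ S, z m * Complex.exp ((2 * Real.pi * (α + m) * x : ℝ) * Complex.I)) *
        Complex.exp (-((2 * Real.pi * b * θ * triWave x : ℝ) : ℂ) * Complex.I)) * Complex.exp (-(2 * Real.pi * (α + m') * x : ℝ) * Complex.I)‖ ^ 2)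
      (∑ m ∈ S, ‖z m‖ ^ 2) := by
  have hgu : Continuous fun x : ℝ => (∑ m ∈ S, z m * Complex.exp ((2 * Real.pi * (α + m) * x : ℝ) * Complex.I)) *
      Complex.exp (-((2 * Real.pi * b * θ * triWave x : ℝ) : ℂ) * Complex.I) := by
    have := continuous_triWave'
    fun_prop
  have h := hasSum_sq_coeff hgu α
  have e : ∫ x in (-(1 / 2 : ℝ))..(1 / 2), ‖(∑ m ∈ S, z m * Complex.exp ((2 * Real.pi * (α + m) * x : ℝ) * Complex.I)) *
      Complex.exp (-((2 * Real.pi * b * θ * triWave x : ℝ) : ℂ) * Complex.I)‖ ^ 2 = ∑ m ∈ S, ‖z m‖ ^ 2 := by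
    rw [← integral_norm_sq_blochPoly α S z]
    refine intervalIntegral.integral_congr fun x _ => ?_
    rw [norm_mul, norm_transportPhase'', mul_one]
  rw [e] at h
  exact h

/-- **Bessel for the transported column on any finite output set:** `Σ_{m′∈T} |⟨ψu, e_{m′}⟩|² ≤ Σ_{m∈S}‖z m‖²`. [folklore] -/
theorem sum_sq_transport_coeff_le (α b θ : ℝ) (S T : Finset ℤ) (z : ℤ → ℂ) :
    ∑ m' ∈ T, ‖∫ x in (-(1 / 2 : ℝ))..(1 / 2), ((∑ m ∈ S, z m * Complex.exp ((2 * Real.pi * (α + m) * x : ℝ) * Complex.I)) *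
        Complex.exp (-((2 * Real.pi * b * θ * triWave x : ℝ) : ℂ) * Complex.I)) * Complex.exp (-(2 * Real.pi * (α + m') * x : ℝ) * Complex.I)‖ ^ 2 ≤
      ∑ m ∈ S, ‖z m‖ ^ 2 :=
  sum_le_hasSum T (fun _ _ => by positivity) (hasSum_sq_transport_coeff α b θ S z)

/-- **Half of the mass stays in the window.** If every integer `m′` outside the finite output window `W` has `|α+m′| ≥ R > 0`, then
`Σ_{m∈S}‖z m‖² ≤ Σ_{m′∈W} |⟨ψu,e_{m′}⟩|² + (θ′²+2)(Σ_S (α+m)²‖z‖² + (bθ/θ′)²Σ_S‖z‖²)/R²` (Parseval, and the tail `Σ_{m′∉W} |c|² ≤ R⁻²·Σ (α+m′)²|c|²`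
bounded by the rescaled analytic core on every finite piece of the complement). [folklore] -/
theorem sum_sq_transport_coeff_window_ge (α b θ : ℝ) {θ' : ℝ} (hθ' : θ' ≠ 0) (S W : Finset ℤ) (z : ℤ → ℂ) {R : ℝ} (hR : 0 < R)
    (hW : ∀ m' : ℤ, m' ∉ W → R ≤ |α + m'|) :
    ∑ m ∈ S, ‖z m‖ ^ 2 ≤
      (∑ m' ∈ W, ‖∫ x in (-(1 / 2 : ℝ))..(1 / 2), ((∑ m ∈ S, z m * Complex.exp ((2 * Real.pi * (α + m) * x : ℝ) * Complex.I)) *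
        Complex.exp (-((2 * Real.pi * b * θ * triWave x : ℝ) : ℂ) * Complex.I)) * Complex.exp (-(2 * Real.pi * (α + m') * x : ℝ) * Complex.I)‖ ^ 2) +
      (θ' ^ 2 + 2) * (∑ m ∈ S, (α + m) ^ 2 * ‖z m‖ ^ 2 + (b * θ / θ') ^ 2 * ∑ m ∈ S, ‖z m‖ ^ 2) / R ^ 2 := by
  obtain ⟨c, hc⟩ : ∃ c : ℤ → ℂ, ∀ m' : ℤ, c m' = ∫ x in (-(1 / 2 : ℝ))..(1 / 2), ((∑ m ∈ S, z m * Complex.exp ((2 * Real.pi * (α + m) * x : ℝ) * Complex.I)) *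
      Complex.exp (-((2 * Real.pi * b * θ * triWave x : ℝ) : ℂ) * Complex.I)) * Complex.exp (-(2 * Real.pi * (α + m') * x : ℝ) * Complex.I) := ⟨_, fun _ => rfl⟩
  have hP := hasSum_sq_transport_coeff α b θ S z
  simp only [← hc] at hP ⊢
  set G : ℝ := (θ' ^ 2 + 2) * (∑ m ∈ S, (α + m) ^ 2 * ‖z m‖ ^ 2 + (b * θ / θ') ^ 2 * ∑ m ∈ S, ‖z m‖ ^ 2) with hG
  have hR2 : 0 < R ^ 2 := by positivity
  -- every finite superset `T ⊇ W` of the window: `Σ_T |c|² ≤ Σ_W |c|² + G/R²`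
  have key : ∀ T : Finset ℤ, W ≤ T → ∑ m' ∈ T, ‖c m'‖ ^ 2 ≤ (∑ m' ∈ W, ‖c m'‖ ^ 2) + G / R ^ 2 := by
    intro T hWT
    rw [← Finset.sum_sdiff hWT]
    have h1 : ∀ m' ∈ T \ W, ‖c m'‖ ^ 2 ≤ (α + m') ^ 2 * ‖c m'‖ ^ 2 / R ^ 2 := by
      intro m' hm'
      have hm'W : m' ∉ W := (Finset.mem_sdiff.1 hm').2
      have hR' : R ≤ |α + m'| := hW m' hm'W
      rw [le_div_iff₀ hR2]
      have hsq : R ^ 2 ≤ (α + m') ^ 2 := by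
        rw [← sq_abs (α + m')]
        exact pow_le_pow_left₀ hR.le hR' 2
      have hn := sq_nonneg ‖c m'‖
      nlinarith
    have htail : ∑ m' ∈ T \ W, ‖c m'‖ ^ 2 ≤ G / R ^ 2 := by
      calc ∑ m' ∈ T \ W, ‖c m'‖ ^ 2 ≤ ∑ m' ∈ T \ W, (α + m') ^ 2 * ‖c m'‖ ^ 2 / R ^ 2 := Finset.sum_le_sum h1
        _ = (∑ m' ∈ T \ W, (α + m') ^ 2 * ‖c m'‖ ^ 2) / R ^ 2 := by rw [Finset.sum_div]
        _ ≤ G / R ^ 2 := by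
            refine div_le_div_of_nonneg_right ?_ hR2.le
            have h2 := weighted_coeff_sum_transport_le_rescaled α b θ hθ' S (T \ W) z
            simp only [← hc] at h2
            exact h2
    linarith
  exact le_of_tendsto hP (Filter.eventually_atTop.2 ⟨W, key⟩)

/-- **Cauchy–Schwarz in the duality form:** `(Σ_W x)² ≤ (Σ_W x/w)·(Σ_W w·x)` for `x ≥ 0` and weights `w > 0`. [folklore] -/
theorem sq_sum_le_sum_div_mul_sum_mul {ι : Type*} (W : Finset ι) (w x : ι → ℝ) (hw : ∀ i ∈ W, 0 < w i) (hx : ∀ i ∈ W, 0 ≤ x i) :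
    (∑ i ∈ W, x i) ^ 2 ≤ (∑ i ∈ W, x i / w i) * (∑ i ∈ W, w i * x i) := by
  have h := Finset.sum_mul_sq_le_sq_mul_sq W (fun i => Real.sqrt (x i / w i)) (fun i => Real.sqrt (w i * x i))
  have e1 : ∑ i ∈ W, Real.sqrt (x i / w i) * Real.sqrt (w i * x i) = ∑ i ∈ W, x i := by
    refine Finset.sum_congr rfl fun i hi => ?_
    have hwi := hw i hi
    have hxi := hx i hi
    rw [← Real.sqrt_mul (div_nonneg hxi hwi.le), show x i / w i * (w i * x i) = x i * x i by field_simp,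
      Real.sqrt_mul_self hxi]
  have e2 : ∑ i ∈ W, Real.sqrt (x i / w i) ^ 2 = ∑ i ∈ W, x i / w i :=
    Finset.sum_congr rfl fun i hi => Real.sq_sqrt (div_nonneg (hx i hi) (hw i hi).le)
  have e3 : ∑ i ∈ W, Real.sqrt (w i * x i) ^ 2 = ∑ i ∈ W, w i * x i :=
    Finset.sum_congr rfl fun i hi => Real.sq_sqrt (mul_nonneg (hw i hi).le (hx i hi))
  rw [e1, e2, e3] at h
  exact h

/-- **THE ENERGY-FORM TRANSPORT LOWER BOUND FOR A LOW COLUMN (input-energy lower bound for once-transported pairs).**  For a class offset `α`, a line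
`b ≠ 0`, a strain `θ`, an auxiliary `θ′ ≠ 0`, a finite set `S` of source rows with amplitudes `z` band-limited by `H` (`(α+m)²‖z m‖² ≤ H²‖z m‖²` on
`S`), and a finite output window `W` whose complement lies at `|α+m′| ≥ R > 0`: if `2·G ≤ R²` with `G = (θ′²+2)(H² + (bθ/θ′)²)`, then
`Σ_{m∈S}‖z m‖² / (4(G + b²)) ≤ Σ_{m′∈W} |∫_{−½}^{½} (Σ_{m∈S} z(m)e^{2πi(α+m)x})·e^{−2πibθ·tri(x)}·e^{−2πi(α+m′)x} dx|² / ((α+m′)²+b²)` — p4's `vTransport`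
keeps at least the fraction `1/(4(G+b²))` of the column's `ℓ²` mass as windowed level energy: this is `‖ζ∘Φ‖_{Ḣ⁻¹} ≥ c‖ζ‖` for the shear `Φ` on
band-limited sheets, on the lattice with 1-D Fourier analysis only (Parseval + truncation tail + duality). [cite: ElgindiLissMattingly2025, §1 (H_α, V_α)] -/
theorem transport_column_energy_lower (α θ : ℝ) {b : ℝ} (hb : b ≠ 0) {θ' : ℝ} (hθ' : θ' ≠ 0) (S W : Finset ℤ) (z : ℤ → ℂ) {H R : ℝ} (hR : 0 < R)
    (hH : ∀ m ∈ S, (α + m) ^ 2 * ‖z m‖ ^ 2 ≤ H ^ 2 * ‖z m‖ ^ 2) (hW : ∀ m' : ℤ, m' ∉ W → R ≤ |α + m'|)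
    (hG : 2 * ((θ' ^ 2 + 2) * (H ^ 2 + (b * θ / θ') ^ 2)) ≤ R ^ 2) :
    (∑ m ∈ S, ‖z m‖ ^ 2) / (4 * ((θ' ^ 2 + 2) * (H ^ 2 + (b * θ / θ') ^ 2) + b ^ 2)) ≤
      ∑ m' ∈ W, ‖∫ x in (-(1 / 2 : ℝ))..(1 / 2), ((∑ m ∈ S, z m * Complex.exp ((2 * Real.pi * (α + m) * x : ℝ) * Complex.I)) *
        Complex.exp (-((2 * Real.pi * b * θ * triWave x : ℝ) : ℂ) * Complex.I)) * Complex.exp (-(2 * Real.pi * (α + m') * x : ℝ) * Complex.I)‖ ^ 2 /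
          ((α + m') ^ 2 + b ^ 2) := by
  obtain ⟨c, hc⟩ : ∃ c : ℤ → ℂ, ∀ m' : ℤ, c m' = ∫ x in (-(1 / 2 : ℝ))..(1 / 2), ((∑ m ∈ S, z m * Complex.exp ((2 * Real.pi * (α + m) * x : ℝ) * Complex.I)) *
      Complex.exp (-((2 * Real.pi * b * θ * triWave x : ℝ) : ℂ) * Complex.I)) * Complex.exp (-(2 * Real.pi * (α + m') * x : ℝ) * Complex.I) := ⟨_, fun _ => rfl⟩
  -- the four inputs, in terms of `c`
  have hmass := sum_sq_transport_coeff_window_ge α b θ hθ' S W z hR hW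
  have hbessel := sum_sq_transport_coeff_le α b θ S W z
  have hcore := weighted_coeff_sum_transport_le_rescaled α b θ hθ' S W z
  simp only [← hc] at hmass hbessel hcore ⊢
  set A0 : ℝ := ∑ m ∈ S, ‖z m‖ ^ 2 with hA0
  set A2 : ℝ := ∑ m ∈ S, (α + m) ^ 2 * ‖z m‖ ^ 2 with hA2
  set G : ℝ := (θ' ^ 2 + 2) * (H ^ 2 + (b * θ / θ') ^ 2) with hGdef
  set MW : ℝ := ∑ m' ∈ W, ‖c m'‖ ^ 2 with hMW
  set EW : ℝ := ∑ m' ∈ W, ‖c m'‖ ^ 2 / ((α + m') ^ 2 + b ^ 2) with hEW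
  set UW : ℝ := ∑ m' ∈ W, ((α + m') ^ 2 + b ^ 2) * ‖c m'‖ ^ 2 with hUW
  have hA0p : 0 ≤ A0 := Finset.sum_nonneg fun _ _ => by positivity
  have hA2le : A2 ≤ H ^ 2 * A0 := by
    rw [hA2, hA0, Finset.mul_sum]; exact Finset.sum_le_sum hH
  have hθ2 : 0 < θ' ^ 2 + 2 := by positivity
  have hGp : 0 ≤ G := by positivity
  have hb2 : 0 < b ^ 2 := by positivity
  have hW0 : ∀ m' ∈ W, 0 < (α + m') ^ 2 + b ^ 2 := fun m' _ => by positivity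
  have hEWp : 0 ≤ EW := Finset.sum_nonneg fun m' _ => by positivity
  -- (1) the core quantity `(θ′²+2)(A2 + (bθ/θ′)²A0) ≤ G·A0`
  have hcoreG : (θ' ^ 2 + 2) * (A2 + (b * θ / θ') ^ 2 * A0) ≤ G * A0 := by
    rw [hGdef]
    have : A2 + (b * θ / θ') ^ 2 * A0 ≤ (H ^ 2 + (b * θ / θ') ^ 2) * A0 := by nlinarith
    calc (θ' ^ 2 + 2) * (A2 + (b * θ / θ') ^ 2 * A0) ≤ (θ' ^ 2 + 2) * ((H ^ 2 + (b * θ / θ') ^ 2) * A0) :=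
          mul_le_mul_of_nonneg_left this hθ2.le
      _ = (θ' ^ 2 + 2) * (H ^ 2 + (b * θ / θ') ^ 2) * A0 := by ring
  -- (2) half of the mass stays in the window
  have hR2 : 0 < R ^ 2 := by positivity
  have hhalf : A0 / 2 ≤ MW := by
    have h1 : (θ' ^ 2 + 2) * (A2 + (b * θ / θ') ^ 2 * A0) / R ^ 2 ≤ A0 / 2 := by
      rw [div_le_iff₀ hR2]
      have : G * A0 * 2 ≤ A0 * R ^ 2 := by nlinarith
      nlinarith
    linarith
  -- (3) the weighted mass in the window
  have hUW_le : UW ≤ (G + b ^ 2) * A0 := by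
    have e : UW = (∑ m' ∈ W, (α + m') ^ 2 * ‖c m'‖ ^ 2) + b ^ 2 * MW := by
      rw [hUW, hMW, Finset.mul_sum, ← Finset.sum_add_distrib]
      exact Finset.sum_congr rfl fun m' _ => by ring
    rw [e]
    have h2 : b ^ 2 * MW ≤ b ^ 2 * A0 := mul_le_mul_of_nonneg_left hbessel hb2.le
    nlinarith [hcore.trans hcoreG]
  -- (4) Cauchy–Schwarz: `MW² ≤ EW · UW`
  have hCS : MW ^ 2 ≤ EW * UW := by
    have h := sq_sum_le_sum_div_mul_sum_mul W (fun m' => (α + m') ^ 2 + b ^ 2) (fun m' => ‖c m'‖ ^ 2) hW0 (fun _ _ => by positivity)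
    simpa only [hMW, hEW, hUW] using h
  -- (5) conclude
  have hden : 0 < 4 * (G + b ^ 2) := by positivity
  rw [div_le_iff₀ hden]
  rcases eq_or_lt_of_le hA0p with hA | hA
  · rw [← hA]; positivity
  · have hMWp : 0 < MW := lt_of_lt_of_le (by linarith) hhalf
    have hUWp : 0 < UW := by
      rcases le_or_gt UW 0 with hU | hU
      · exfalso
        have : MW ^ 2 ≤ 0 := hCS.trans (by nlinarith)
        nlinarith
      · exact hU
    -- `A0²/4 ≤ MW² ≤ EW·UW ≤ EW·(G+b²)·A0`
    have h3 : A0 ^ 2 / 4 ≤ EW * ((G + b ^ 2) * A0) := by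
      have h1 : A0 ^ 2 / 4 ≤ MW ^ 2 := by
        have : (A0 / 2) ^ 2 ≤ MW ^ 2 := pow_le_pow_left₀ (by linarith) hhalf 2
        linarith [this]
      exact h1.trans (hCS.trans (mul_le_mul_of_nonneg_left hUW_le hEWp))
    nlinarith

end Summit.AnomalousDissipation.AnomalousDissipation.Theorems.SawtoothPulseCascade.K2PhaseBudget

end
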